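import Summits.QuantumFields.YangMills.Theorems.BalabanUVNodesN06AtRecord9CB10Y
import Literature.MathematicalPhysics.QuantumFieldTheory.Balaban1983to89.Node00.Record11CarriersB8

/-!
# BalabanUVNodes ∕ N06 ([B9], `Dag.B9_main`) RE-KEYED AT NODE 00's STAGE-11 CARRIER RECORD `Node00.IsRecordOfRecord₁₁CB10YZW` (and its five-pin sequel
# `IsRecordOfRecord₁₁CB10YZWB8`) — the ₁₁ twin of `BalabanUVNodesN06AtRecord9CB10Y`: READINGS · CLOSERS BY NAME in both currencies (the ∀-form stub `S_N06` and the
# pointed ∃-currency of K1 `StabilityBAtRecordR11e`) · THE KNIT at a presenting package with the genuine lattice norms (3.39)–(3.41) pinned · GUARDS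

Track A of `YM-PLAN.md` (cell `pub-ymgap`, HUMAN RULING D-0062), node **N06** = [Balaban1985BackgroundPropagators] Thms 3.1–3.15; R134 fan-out seat
`pub-ymgap-dag-n06-d` (strategy s2 = BY-NAME KNIT ∕ REDUCTION at the ₁₁ record; dag-lead FAN-OUT v1.1 §N06 s2).  The route `BalabanUVNodes` was RESTATED at
def-T's Stage-11 record (rev 6, T-day 2026-08-26): K1 `StabilityBAtRecordR11e` quantifies over `Node00.IsRecordOfRecord₁₁C F 2`; node00-def g31's
`Node00/Record11Carriers.lean` (p445559) ∕ `Record11CarriersB8.lean` (p446171) put the four ∕ five typed carrier groups on top of it with THE SAME datum and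
world (`IsRecordOfRecord₁₁CB10YZW → IsRecordOfRecord₁₁C`).  This module moves the (W2) closer set of N06 (`BalabanUVNodesN06AtRecord9CB10Y`, p428119, over g29's
₉CB10Y) to that record BY NAME — nothing of [B9] is restated, the knit `N06AtRecord9CB10Y.b9LeafX_Y9OfRecord_of_obligations` and def-Y's located vacuity
certificate `exists_junkOps_b9LeafX_Y9OfRecord` are IMPORTED, not re-derived.  Kernel bookkeeping: 0 `def`, 0 `sorry`, standard axioms.  COUNT-NEUTRAL;
`--supports` item K1 `StabilityBAtRecordR11e` (stmt-QuantumFields-19674).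

THE REFINEMENT OF RECORD used for the in-edges is `₁₁CB10YZW → ₁₁C → ₅C AT THE SHADOW` (def-T `Record11` §8: «`IsRecordOfRecord₁₁C → IsRecordOfRecord₁₀C` does
NOT hold at the datum; what holds is the ₅C refinement at the shadow», `Node00.atWorld_of_isRecordOfRecord₁₁CB10YZW`): N01 ∕ N02 ∕ N03 ∕ N04 are NODE 00 theorems
over ₅C (`b4∕b5∕b7_main_of_isRecordOfRecord₅C`, `N03_at_record₅C`), so `b4 b5 b6 b7` HOLD at every run of every ₁₁CB10YZW record and N06 there IS the bare leaf
`b9`, which g31's `leaves_iff_of_isRecordOfRecord₁₁CB10YZW` reads as def-Y's extended leaf `B9LeafX (Y9OfRecord N θ.toStage3Params M⋆ ops)` at the [B9] bundle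
of record of the presenting package — index `MemberY`, geometry `geo9Y` (= dag-n03-b's reading `geo9K` of `Node00.kGeoU`: THE GENUINE LATTICE NORMS (3.39)–(3.41)
of [B9] Sect. A p. 397 on the record's own k-level tori, `B9GeoNormsKLevelV1`), backgrounds `bg9Y` in `SU(N) ⊂ M_N(ℂ)`, the OPERATOR LAYER `ops : OpsY N θ₃ M⋆`
residual (def-Y's `OperatorLayerY`, 23 fields, no law).

WHAT THIS MODULE PROVES.
* §1 READINGS: `s_N06_iff₁₁CB10YZW` (`Iff.rfl`) · `guards_of_isRecordOfRecord₁₁CB10YZW` · `b9_main_iff_leaf_of_…` · `b9_main_iff_leafX_of_…` · `s_N06_iff_leaf₁₁CB10YZW`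
  · THE NEW FACE `s_N06_iff₁₁CB10YZW_bundles`: `S_N06 (₁₁CB10YZW)` ⟺ «for every family, every admissible `θ : Stage11Params` with its provisos and `0 < θ.γ`, every
  floor and EVERY operator layer: `B9LeafX (Y9OfRecord N θ.toStage3Params M⋆ ops)`».
* §2 CLOSERS BY NAME, ∀-currency: `b9_main_of_isRecordOfRecord₁₁CB10YZW_of_slot` (per record) ∕ `s_N06_record₁₁CB10YZW_of_leafSlot` (package slot in
  `Record11Carriers`' letters — the `b9` component of g31's `b9_b11_b15_main_of_isRecordOfRecord₁₁CB10YZW_of_slots`, separated so a (B)-side glue can enter N06 alone),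
  `…_of_bundleSlot`, `s_N06_of_refines₁₁CB10YZW`, `s_N06_record₁₁CB10YZWB8_of_bundleSlot` (the five-pin record).
  ∃-currency (K1 V1: the prover CHOOSES the record): `b9_main_of_up_view₁₁B10YZW` ∕ `b9_main_of_up_view₁₁B8B10YZW` — at ANY world bound over g31's four- ∕ five-pin
  Stage-11 view of a package `(θ, M⋆, ops, ζ, λ_W)`, def-Y's leaf at `(θ₃, M⋆, ops)` gives `Dag.B9_main` at every run — and **`b9_main_of_up_view₁₁B10YZW_of_obligations`**,
  THE KNIT AT ₁₁: `Dag.B9_main` at every run of such a world FROM EXACTLY the operator layer's obligations (the eight `U = 1` comparisons against NODE 00's readings,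
  the two null readings, the residual entries, the Sect.-B step, the gauge reduction, the sixteen whole-statement leaves of [B9]) — the [B6] block discharged by
  N03's `Node00.b6BlockParam_D6OfRecord`, every geometric hypothesis by def-Y's MODULES 2–5 (imported knit `b9LeafX_Y9OfRecord_of_obligations`).
* §3 GUARDS — THE HONESTY OF THE MODULE (ref-A's clause of record carried to ₁₁): `exists_record₁₁CB10YZW_leaf_iff` · `b9LeafX_of_s_N06_record₁₁CB10YZW` (the ∀-form
  FORCES the leaf at every operator layer) · `not_s_N06_record₁₁CB10YZW_of_badOps` (one bad layer refutes it — the ∀-form over ₁₁CB10YZW is NOT an N06 target) ·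
  `exists_record₁₁CB10YZW_b9_main_junk` (the zero layer presents records at which N06 holds by `exact`) · `inhabited₁₁CB10YZW_iff_inhabited₁₁C` (the pins add no
  proviso: INHABITED-AT-₁₁CB10YZW ⟺ K0 `Record11Inhabited`'s body at `N`, neither proved nor assumed here) · **`exists_rebind₁₁CB10YZW_b9_main_of_isRecordOfRecord₁₁C`**
  (K1-currency honesty, LOCATED: EVERY ₁₁C record's datum is presented — same `D`, `C`, `γ`, `L` — by a ₁₁CB10YZW world at which `Dag.B9_main` holds at every run,
  through the junk layer; so in K1's ∃-form the N06 conjunct of `DagBinding.Nodes` certifies nothing about Bałaban's propagators until the operator layer is an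
  object of record — FAN-OUT §N06 row s1 (β), XL).

HONEST FRAMING.  [B9]'s Theorems 3.1–3.15 are NOT proved here or anywhere in the tree for Bałaban's operators `G′(U), G(U), …`; every closer takes the leaf ∕
the operator-layer obligations AS HYPOTHESES; N06 is NOT discharged (typed 28∕28, discharged 5∕27 untouched by this file); one finite four-torus programme at fixed
`ε` — NOT ℝ⁴, NOT infinite volume, NOT OS, NOT a mass gap, NOT Clay.  Restate-immune (no `def`).
-/

noncomputable section

namespace Summit.QuantumFields.YangMills.BalabanUVNodes.N06AtRecord11CB10YZW

open Literature.MathematicalPhysics.QuantumFieldTheory.Balaban1983to89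
open Literature.MathematicalPhysics.QuantumFieldTheory.Balaban1983to89.T4Continuum (T4Family FiniteEpsData)
open Literature.MathematicalPhysics.QuantumFieldTheory.Balaban1983to89.DagBinding (WorldP leavesP B9LeafX B6BlockParam)
open Literature.MathematicalPhysics.QuantumFieldTheory.Balaban1983to89.Node00
open Literature.MathematicalPhysics.QuantumFieldTheory.Balaban1983to89.B9PinMembersKLevelV1 (MemberY geo9Y bg9Y)
open Literature.MathematicalPhysics.QuantumFieldTheory.Balaban1983to89.B9PinGeometryKLevelV1 (dOmegaY OmKY inΛY unitDistY InCubeY c35Y)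
open Literature.MathematicalPhysics.QuantumFieldTheory.Balaban1983to89.B7Prop2SpecialUnitary (specialUnitaryUnits)
open YMDAG.UVSplit (RecordPred Datum AtRecord S_N06)
open Summit.QuantumFields.YangMills.BalabanUVNodes.N06AtRecord9CB10Y (b9LeafX_Y9OfRecord_of_obligations exists_junkOps_b9LeafX_Y9OfRecord)
open scoped Matrix.Norms.L2Operator

variable {N : ℕ} [NeZero N]

/-! ## §1 readings at the Stage-11 carrier record -/

/-- **What `S_N06` says over the Stage-11 carrier record** (`Iff.rfl`): at every ₁₁CB10YZW record and every run, `Dag.B9_main`.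
[cite: Balaban1985BackgroundPropagators, Thms 3.1–3.15 pp.397–432 (the node's shape `Dag.B9_main`, bookkeeping)] -/
theorem s_N06_iff₁₁CB10YZW :
    S_N06 (fun F D w => IsRecordOfRecord₁₁CB10YZW F N D w) ↔
      ∀ (F : T4Family) (D : Datum F N) (w : WorldP), IsRecordOfRecord₁₁CB10YZW F N D w → ∀ P : B12.RunParams, Dag.B9_main (leavesP w P) :=
  Iff.rfl

section Record

variable {F : T4Family} {D : FiniteEpsData F (Node00.SU N)} {w : WorldP}

/-- **In-edge guards at every run of a ₁₁CB10YZW record**: `b4 b5 b6 b7` HOLD — N01 ∕ N02 ∕ N03 ∕ N04 are NODE 00 theorems at the Stage-5 shadow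
(`b4∕b5∕b7_main_of_isRecordOfRecord₅C`, `N03_at_record₅C`), transferred by g31's `atWorld_of_isRecordOfRecord₁₁CB10YZW` (def-T's ₅C-at-the-shadow refinement of
`Record11` §8; same world). [cite: Balaban1983RegularityDecay, Theorem p.573; Balaban1984PropagatorsI, Props. 1.1–1.2 pp.33–36; Balaban1984PropagatorsII, Lemma 2.1 – Cor. 2.8 pp.234–249; Balaban1985Averaging, Props. 1–10 pp.26–50 (kernel versions at the objects of record; bookkeeping, transferred)] -/
theorem guards_of_isRecordOfRecord₁₁CB10YZW (h : IsRecordOfRecord₁₁CB10YZW F N D w) (P : B12.RunParams) :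
    (leavesP w P).b4 ∧ (leavesP w P).b5 ∧ (leavesP w P).b6 ∧ (leavesP w P).b7 :=
  atWorld_of_isRecordOfRecord₁₁CB10YZW (X := fun ℓ => ℓ.b4 ∧ ℓ.b5 ∧ ℓ.b6 ∧ ℓ.b7)
    (fun _ _ h5 Q =>
      have h4 := b4_main_of_isRecordOfRecord₅C h5 Q
      have hb5 := b5_main_of_isRecordOfRecord₅C h5 Q h4
      ⟨h4, hb5, N03_at_record₅C h5 Q h4 hb5, b7_main_of_isRecordOfRecord₅C h5 Q hb5⟩)
    h P

/-- **At a ₁₁CB10YZW record N06 IS THE BARE LEAF `b9`** (the four discharged in-edges drop out). [cite: Balaban1985BackgroundPropagators, Thms 3.1–3.15 pp.397–432 (bookkeeping)] -/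
theorem b9_main_iff_leaf_of_isRecordOfRecord₁₁CB10YZW (h : IsRecordOfRecord₁₁CB10YZW F N D w) (P : B12.RunParams) :
    Dag.B9_main (leavesP w P) ↔ (leavesP w P).b9 := by
  obtain ⟨h4, h5, h6, h7⟩ := guards_of_isRecordOfRecord₁₁CB10YZW h P
  exact ⟨fun hm => hm h4 h5 h6 h7, fun hb _ _ _ _ => hb⟩

/-- **At a ₁₁CB10YZW record N06 IS def-Y's EXTENDED LEAF AT THE [B9] BUNDLE OF RECORD** of the presenting package: for the record's Stage-11 parameter `θ`, floor
`M⋆` and operator layer `ops`, `Dag.B9_main (leavesP w P) ↔ B9LeafX (Y9OfRecord N θ.toStage3Params M⋆ ops)` at every run (g31's `leaves_iff_of_isRecordOfRecord₁₁CB10YZW`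
+ the guards).  The bundle's geometry is `geo9Y` — the genuine lattice norms (3.39)–(3.41) on the record's k-level tori — and its backgrounds `bg9Y` in
`SU(N) ⊂ M_N(ℂ)`; only `ops` and `M⋆` are residual. [cite: Balaban1985BackgroundPropagators, Thms 3.1–3.15 pp.397–432; Sect. A (3.39)–(3.41) p.397 (the pinned norms)] -/
theorem b9_main_iff_leafX_of_isRecordOfRecord₁₁CB10YZW (h : IsRecordOfRecord₁₁CB10YZW F N D w) :
    ∃ (θ : Stage11Params F N) (Mstar : ℕ) (ops : OpsY N θ.toStage3Params Mstar), θ.Admissible ∧ w.L = (θ.L : ℝ) ∧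
      ∀ P : B12.RunParams, Dag.B9_main (leavesP w P) ↔ B9LeafX (Y9OfRecord N θ.toStage3Params Mstar ops) := by
  obtain ⟨θ, Mstar, ops, ζ, lamW, hθ, hL, hl⟩ := leaves_iff_of_isRecordOfRecord₁₁CB10YZW h
  exact ⟨θ, Mstar, ops, hθ, hL, fun P => (b9_main_iff_leaf_of_isRecordOfRecord₁₁CB10YZW h P).trans (hl P).2.1⟩

end Record

/-- **`S_N06` over ₁₁CB10YZW IS «the leaf `b9` at every run of every record»**. [cite: Balaban1985BackgroundPropagators, Thms 3.1–3.15 pp.397–432 (bookkeeping)] -/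
theorem s_N06_iff_leaf₁₁CB10YZW :
    S_N06 (fun F D w => IsRecordOfRecord₁₁CB10YZW F N D w) ↔
      ∀ (F : T4Family) (D : Datum F N) (w : WorldP), IsRecordOfRecord₁₁CB10YZW F N D w → ∀ P : B12.RunParams, (leavesP w P).b9 :=
  ⟨fun h F D w hR P => (b9_main_iff_leaf_of_isRecordOfRecord₁₁CB10YZW hR P).1 (h F D w hR P),
    fun h F D w hR P => (b9_main_iff_leaf_of_isRecordOfRecord₁₁CB10YZW hR P).2 (h F D w hR P)⟩

/-! ## §2 closers BY NAME — ∀-currency (the stub `S_N06`) -/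

/-- **N06 AT ONE ₁₁CB10YZW RECORD FROM ITS LEAF SLOT, PACKAGE FORM** (in `Record11Carriers`' letters — exactly the `b9` component of the `hYZW` hypothesis of g31's
`b9_b11_b15_main_of_isRecordOfRecord₁₁CB10YZW_of_slots`, separated so that a (B)-side glue can enter N06 alone): if for every package `(θ, h, M⋆, ops, ζ, λ_W)`
PRESENTING the record the extended leaf holds at the bundle of record, then `Dag.B9_main` at every run (in-edges unused).  The slot quantifies over the HIDDEN
operator layer — honest, and §3 says what that costs. [cite: Balaban1985BackgroundPropagators, Thms 3.1–3.15 pp.397–432 (bookkeeping)] -/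
theorem b9_main_of_isRecordOfRecord₁₁CB10YZW_of_slot {F : T4Family} {D : Datum F N} {w : WorldP} (h : IsRecordOfRecord₁₁CB10YZW F N D w)
    (hY : ∀ (θ : Stage11Params F N) (hP : θ.Provisos₁₁) (Mstar : ℕ) (ops : OpsY N θ.toStage3Params Mstar) (ζ : ResidZ F N) (lamW : ResidW F N),
      θ.Admissible → D = datumOfRecord₁₁ F N θ hP → (∀ P, w.up P = upOfRecord₅C F N (θ.view₁₁B10YZW F N Mstar ops ζ lamW) P) →
        B9LeafX (Y9OfRecord N θ.toStage3Params Mstar ops))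
    (P : B12.RunParams) : Dag.B9_main (leavesP w P) := by
  obtain ⟨θ, hP, Mstar, ops, ζ, lamW, hθ, hD, -, -, -, hup⟩ := h
  intro _ _ _ _
  show (w.up P).b9
  rw [hup P]
  exact (upOfRecord₅C_view₁₁B10YZW_leaves F N θ Mstar ops ζ lamW P).2.1.2 (hY θ hP Mstar ops ζ lamW hθ hD hup)

/-- **`S_N06 (₁₁CB10YZW)` FROM THE LEAF SLOT, PACKAGE FORM**: if for every record and every package `(θ, h, M⋆, ops, ζ, λ_W)` PRESENTING it the extended leaf holds
at the bundle of record, then `S_N06` over ₁₁CB10YZW (`b9_main_of_isRecordOfRecord₁₁CB10YZW_of_slot` at every record).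
[cite: Balaban1985BackgroundPropagators, Thms 3.1–3.15 pp.397–432 (bookkeeping)] -/
theorem s_N06_record₁₁CB10YZW_of_leafSlot
    (hslot : ∀ (F : T4Family) (D : Datum F N) (w : WorldP), IsRecordOfRecord₁₁CB10YZW F N D w →
      ∀ (θ : Stage11Params F N) (hP : θ.Provisos₁₁) (Mstar : ℕ) (ops : OpsY N θ.toStage3Params Mstar) (ζ : ResidZ F N) (lamW : ResidW F N),
        θ.Admissible → D = datumOfRecord₁₁ F N θ hP →
        (∀ P, w.up P = upOfRecord₅C F N (θ.view₁₁B10YZW F N Mstar ops ζ lamW) P) →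
          B9LeafX (Y9OfRecord N θ.toStage3Params Mstar ops)) :
    S_N06 (fun F D w => IsRecordOfRecord₁₁CB10YZW F N D w) :=
  fun F D w h P => b9_main_of_isRecordOfRecord₁₁CB10YZW_of_slot h (hslot F D w h) P

/-- **`S_N06 (₁₁CB10YZW)` FROM THE LEAF SLOT, BUNDLE FORM**: if the extended leaf holds at the [B9] bundle of record `Y9OfRecord N θ₃ M⋆ ops` for EVERY Stage-3
dictionary with admissible Stage-1 part, EVERY floor and EVERY operator layer, then `S_N06` over ₁₁CB10YZW.  (This is what a proof of the ∀-form must supply —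
§3 `b9LeafX_of_s_N06_record₁₁CB10YZW` is the converse on the Stage-11-presented dictionaries.) [cite: Balaban1985BackgroundPropagators, Thms 3.1–3.15 pp.397–432 (bookkeeping)] -/
theorem s_N06_record₁₁CB10YZW_of_bundleSlot
    (hslot : ∀ (θ₃ : Stage3Params), θ₃.toStage1Params.Admissible → ∀ (Mstar : ℕ) (ops : OpsY N θ₃ Mstar), B9LeafX (Y9OfRecord N θ₃ Mstar ops)) :
    S_N06 (fun F D w => IsRecordOfRecord₁₁CB10YZW F N D w) := by
  intro F D w h P
  obtain ⟨θ, Mstar, ops, hθ, -, hiff⟩ := b9_main_iff_leafX_of_isRecordOfRecord₁₁CB10YZW h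
  exact (hiff P).2 (hslot θ.toStage3Params hθ.1.1.1.1.1 Mstar ops)

/-- **`S_N06 Rec` FOR EVERY RECORD PREDICATE REFINING ₁₁CB10YZW**, from the bundle slot (refinement-generic: the next carrier pins re-key by this line).
[cite: Balaban1985BackgroundPropagators, Thms 3.1–3.15 pp.397–432 (bookkeeping)] -/
theorem s_N06_of_refines₁₁CB10YZW (Rec : RecordPred N)
    (href : ∀ (F : T4Family) (D : Datum F N) (w : WorldP), Rec F D w → IsRecordOfRecord₁₁CB10YZW F N D w)
    (hslot : ∀ (θ₃ : Stage3Params), θ₃.toStage1Params.Admissible → ∀ (Mstar : ℕ) (ops : OpsY N θ₃ Mstar), B9LeafX (Y9OfRecord N θ₃ Mstar ops)) :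
    S_N06 Rec :=
  fun F D w hR P => s_N06_record₁₁CB10YZW_of_bundleSlot hslot F D w (href F D w hR) P

/-- **`S_N06` AT THE FIVE-PIN STAGE-11 RECORD `IsRecordOfRecord₁₁CB10YZWB8`** (all five typed carrier groups pinned, `b8` surviving — g31's `Record11CarriersB8`),
from the bundle slot: the [B9] face is the four-pin one (`leaves_iff_of_isRecordOfRecord₁₁CB10YZWB8`, in-edges `b4_b5_b6_b7_of_…` via the same-datum companion).
[cite: Balaban1985BackgroundPropagators, Thms 3.1–3.15 pp.397–432; Balaban1985RegularSpaces, Thm 8 p.101 (the [B8] pin; bookkeeping)] -/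
theorem s_N06_record₁₁CB10YZWB8_of_bundleSlot
    (hslot : ∀ (θ₃ : Stage3Params), θ₃.toStage1Params.Admissible → ∀ (Mstar : ℕ) (ops : OpsY N θ₃ Mstar), B9LeafX (Y9OfRecord N θ₃ Mstar ops)) :
    S_N06 (fun F D w => IsRecordOfRecord₁₁CB10YZWB8 F N D w) := by
  intro F D w h P h4 h5 h6 h7
  obtain ⟨θ, lam, Mstar, ops, ζ, lamW, hθ, -, hl⟩ := leaves_iff_of_isRecordOfRecord₁₁CB10YZWB8 h
  exact ((hl P).2.2.1).2 (hslot θ.toStage3Params hθ.1.1.1.1.1 Mstar ops)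

/-! ## §2′ closers BY NAME — ∃-currency (K1 `StabilityBAtRecordR11e`, V1 ∃-form: the prover chooses the package) -/

section Pointed

variable {F : T4Family}

/-- **N06 AT ANY WORLD BOUND OVER THE FOUR-PIN STAGE-11 VIEW, FROM def-Y's LEAF AT THE CHOSEN PACKAGE**: if `w.up P = upOfRecord₅C (θ.view₁₁B10YZW M⋆ ops ζ λ_W) P`
at every run, then `B9LeafX (Y9OfRecord N θ.toStage3Params M⋆ ops)` gives `Dag.B9_main (leavesP w P)` at every run (g31's `upOfRecord₅C_view₁₁B10YZW_leaves`; the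
in-edges are not even needed).  This is the shape K1's prover consumes at the record it CHOOSES. [cite: Balaban1985BackgroundPropagators, Thms 3.1–3.15 pp.397–432 (bookkeeping)] -/
theorem b9_main_of_up_view₁₁B10YZW (θ : Stage11Params F N) (Mstar : ℕ) (ops : OpsY N θ.toStage3Params Mstar) (ζ : ResidZ F N) (lamW : ResidW F N)
    (w : WorldP) (hup : ∀ P, w.up P = upOfRecord₅C F N (θ.view₁₁B10YZW F N Mstar ops ζ lamW) P)
    (hleaf : B9LeafX (Y9OfRecord N θ.toStage3Params Mstar ops)) (P : B12.RunParams) : Dag.B9_main (leavesP w P) := by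
  intro _ _ _ _
  show (w.up P).b9
  rw [hup P]
  exact (upOfRecord₅C_view₁₁B10YZW_leaves F N θ Mstar ops ζ lamW P).2.1.2 hleaf

/-- **… and over the FIVE-PIN Stage-11 view (S-binding, [B8] innermost)**. [cite: Balaban1985BackgroundPropagators, Thms 3.1–3.15 pp.397–432; Balaban1985RegularSpaces, Thm 8 p.101 (bookkeeping)] -/
theorem b9_main_of_up_view₁₁B8B10YZW (θ : Stage11Params F N) (lam : ResidB8 θ.toStage3Params) (Mstar : ℕ) (ops : OpsY N θ.toStage3Params Mstar)
    (ζ : ResidZ F N) (lamW : ResidW F N) (w : WorldP) (hup : ∀ P, w.up P = upOfRecord₅CS F N (θ.view₁₁B8B10YZW F N lam Mstar ops ζ lamW) P)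
    (hleaf : B9LeafX (Y9OfRecord N θ.toStage3Params Mstar ops)) (P : B12.RunParams) : Dag.B9_main (leavesP w P) := by
  intro _ _ _ _
  show (w.up P).b9
  rw [hup P]
  exact (upOfRecord₅CS_view₁₁B8B10YZW_leaves F N θ lam Mstar ops ζ lamW P).2.2.1.2 hleaf

/-- **THE KNIT AT ₁₁ — N06 AT A WORLD BOUND OVER THE FOUR-PIN STAGE-11 VIEW FROM EXACTLY THE OPERATOR LAYER'S OBLIGATIONS.**  For the chosen Stage-11 parameter `θ`
(admissible), floor `M⋆`, operator layer `ops`, [B11] ∕ [IV] layers `ζ, λ_W` and any world `w` bound over `θ.view₁₁B10YZW M⋆ ops ζ λ_W`: the imported knit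
`N06AtRecord9CB10Y.b9LeafX_Y9OfRecord_of_obligations` (def-Y's `b9LeafX_carriersY` at the record's `SU(N) ⊂ M_N(ℂ)` data, the [B6] block DISCHARGED by N03's theorem of
record `Node00.b6BlockParam_D6OfRecord`, every geometric hypothesis — index, (3.35) regularity at `U = 1`, the sign facts of the genuine lattice norms (3.39)–(3.41)
`geo9Y`, the `U = 1` dictionary — by def-Y's MODULES 2–5) composed with `b9_main_of_up_view₁₁B10YZW`.  Displayed, and NOTHING ELSE: the eight `U = 1` comparisons of
`ops` against NODE 00's readings `GpU ∕ CinvU ∕ GU`, the two null readings, the residual entries `hGp ∕ hGA`, the Sect.-B step, the gauge reduction (3.35) and the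
sixteen whole-statement leaves of [B9] (Thm 3.7, Cor 3.8, Thms 3.9–3.15, (3.49), (3.132), Thm 3.14 local) — the operator layer's obligations (FAN-OUT §N06 s1 (β), XL;
NOT proved here). [cite: Balaban1985BackgroundPropagators, Thms 3.1–3.15 pp.397–432; Sect. A (3.35) p.396, (3.39)–(3.41) p.397; Cor. 3.5 proof p.407; Balaban1984PropagatorsII, Props. 2.2–2.7 pp.234–249 (the [B6] block, discharged by name)] -/
theorem b9_main_of_up_view₁₁B10YZW_of_obligations (θ : Stage11Params F N) (hθ : θ.Admissible) (Mstar : ℕ) (ops : OpsY N θ.toStage3Params Mstar)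
    (ζ : ResidZ F N) (lamW : ResidW F N) (w : WorldP) (hup : ∀ P, w.up P = upOfRecord₅C F N (θ.view₁₁B10YZW F N Mstar ops ζ lamW) P)
    (hGp_e : ∀ (x : MemberY θ.d₆ θ.ℓ₆ θ.hd' θ.hL' θ.b₀ θ.b₁ Mstar) (n : Fin 4) (lam : (geo9Y x).Loc) (y : (geo9Y x).Site),
      (ops x).Gp.e n (bg9Y (Matrix (Fin N) (Fin N) ℂ) (specialUnitaryUnits (Fin N)) x).one lam y ≤ (Node00.GpU x.toKIdx).e n lam y)
    (hGp_h1 : ∀ (x : MemberY θ.d₆ θ.ℓ₆ θ.hd' θ.hL' θ.b₀ θ.b₁ Mstar) (lam : (geo9Y x).Loc) (b : ℝ) (c : (geo9Y x).Cut),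
      (ops x).Gp.h1 (bg9Y (Matrix (Fin N) (Fin N) ℂ) (specialUnitaryUnits (Fin N)) x).one lam b c ≤ (Node00.GpU x.toKIdx).h1 lam b c)
    (hC : ∀ (x : MemberY θ.d₆ θ.ℓ₆ θ.hd' θ.hL' θ.b₀ θ.b₁ Mstar) (y y' : (geo9Y x).Site),
      |(ops x).Cinv.ker (bg9Y (Matrix (Fin N) (Fin N) ℂ) (specialUnitaryUnits (Fin N)) x).one y y'| ≤ |(Node00.CinvU x.toKIdx).ker y y'|)
    (hGA_e : ∀ (x : MemberY θ.d₆ θ.ℓ₆ θ.hd' θ.hL' θ.b₀ θ.b₁ Mstar) (n : Fin 4) (lam : (geo9Y x).Loc) (y : (geo9Y x).Site),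
      (ops x).GA.e n (bg9Y (Matrix (Fin N) (Fin N) ℂ) (specialUnitaryUnits (Fin N)) x).one lam y ≤ (Node00.GU x.toKIdx).e n lam y)
    (hGA_h1 : ∀ (x : MemberY θ.d₆ θ.ℓ₆ θ.hd' θ.hL' θ.b₀ θ.b₁ Mstar) (lam : (geo9Y x).Loc) (b : ℝ) (c : (geo9Y x).Cut),
      (ops x).GA.h1 (bg9Y (Matrix (Fin N) (Fin N) ℂ) (specialUnitaryUnits (Fin N)) x).one lam b c ≤ (Node00.GU x.toKIdx).h1 lam b c)
    (hGA_e4 : ∀ (x : MemberY θ.d₆ θ.ℓ₆ θ.hd' θ.hL' θ.b₀ θ.b₁ Mstar) (lam : (geo9Y x).Loc) (y : (geo9Y x).Site),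
      (ops x).GA.e4 (bg9Y (Matrix (Fin N) (Fin N) ℂ) (specialUnitaryUnits (Fin N)) x).one lam y ≤ (Node00.GU x.toKIdx).e4 lam y)
    (hGA_h2 : ∀ (x : MemberY θ.d₆ θ.ℓ₆ θ.hd' θ.hL' θ.b₀ θ.b₁ Mstar) (lam : (geo9Y x).Loc) (b : ℝ) (c : (geo9Y x).Cut),
      (ops x).GA.h2 (bg9Y (Matrix (Fin N) (Fin N) ℂ) (specialUnitaryUnits (Fin N)) x).one lam b c ≤ (Node00.GU x.toKIdx).h2 lam b c)
    (hGA_l2 : ∀ (x : MemberY θ.d₆ θ.ℓ₆ θ.hd' θ.hL' θ.b₀ θ.b₁ Mstar) (n : Fin 6) (lam : (geo9Y x).Loc) (hc : (geo9Y x).Cut),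
      (ops x).GA.l2 n (bg9Y (Matrix (Fin N) (Fin N) ℂ) (specialUnitaryUnits (Fin N)) x).one lam hc ≤ (Node00.GU x.toKIdx).l2 n lam hc)
    (hE4 : ∀ (x : MemberY θ.d₆ θ.ℓ₆ θ.hd' θ.hL' θ.b₀ θ.b₁ Mstar) (lam : (geo9Y x).Loc), ¬ (lam.isRight = true) →
      ∀ y, (ops x).GA.e4 (bg9Y (Matrix (Fin N) (Fin N) ℂ) (specialUnitaryUnits (Fin N)) x).one lam y ≤ 0)
    (hH2 : ∀ (x : MemberY θ.d₆ θ.ℓ₆ θ.hd' θ.hL' θ.b₀ θ.b₁ Mstar) (lam : (geo9Y x).Loc), ¬ (lam.isRight = true) →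
      ∀ (β : ℝ) (c : (geo9Y x).Cut), (ops x).GA.h2 (bg9Y (Matrix (Fin N) (Fin N) ℂ) (specialUnitaryUnits (Fin N)) x).one lam β c ≤ 0)
    (hGp : B9FromB6.ResidualGpAtOne geo9Y (bg9Y (Matrix (Fin N) (Fin N) ℂ) (specialUnitaryUnits (Fin N))) (fun x => (ops x).Gp))
    (hGA : B9FromB6.ResidualGAGlobAtOne geo9Y (bg9Y (Matrix (Fin N) (Fin N) ℂ) (specialUnitaryUnits (Fin N))) (fun x => (ops x).GA))
    (hB : B9.SectBStepPrinted (θ.d₆ + 1) c35Y geo9Y (bg9Y (Matrix (Fin N) (Fin N) ℂ) (specialUnitaryUnits (Fin N))) (fun x => (ops x).Gp)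
      (fun x => (ops x).GA) (fun x => (ops x).Cinv) (fun x => (ops x).IsAnalyticExt))
    (hg : B9.GaugeReduction335 (θ.d₆ + 1) c35Y geo9Y (bg9Y (Matrix (Fin N) (Fin N) ℂ) (specialUnitaryUnits (Fin N))) InCubeY (fun x => (ops x).Gp)
      (fun x => (ops x).GA) (fun x => (ops x).Cinv))
    (t37 : B9.Thm37Printed c35Y geo9Y (bg9Y (Matrix (Fin N) (Fin N) ℂ) (specialUnitaryUnits (Fin N))) (fun x => (ops x).E37))
    (c38 : B9.Cor38Printed c35Y geo9Y (bg9Y (Matrix (Fin N) (Fin N) ℂ) (specialUnitaryUnits (Fin N))) (fun x => (ops x).E37))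
    (t39 : B9.Thm39Printed (θ.d₆ + 1) c35Y geo9Y (bg9Y (Matrix (Fin N) (Fin N) ℂ) (specialUnitaryUnits (Fin N))) (fun x => (ops x).EK39))
    (t310 : B9.Thm310Printed c35Y geo9Y (bg9Y (Matrix (Fin N) (Fin N) ℂ) (specialUnitaryUnits (Fin N))) (fun x => (ops x).E310))
    (hsum : B9.RWSumsYieldIneqs geo9Y (bg9Y (Matrix (Fin N) (Fin N) ℂ) (specialUnitaryUnits (Fin N))) (fun x => (ops x).E37) (fun x => (ops x).E310)
      (fun x => (ops x).Gp) (fun x => (ops x).GA))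
    (hksum : B9.RWKernelSumYields (θ.d₆ + 1) geo9Y (bg9Y (Matrix (Fin N) (Fin N) ℂ) (specialUnitaryUnits (Fin N))) (fun x => (ops x).EK39)
      (fun x => (ops x).Cinv))
    (t311 : B9.Thm311Printed c35Y geo9Y (bg9Y (Matrix (Fin N) (Fin N) ℂ) (specialUnitaryUnits (Fin N))) (fun x => (ops x).PosDef))
    (t312 : B9.Thm312Printed (θ.d₆ + 1) c35Y geo9Y (bg9Y (Matrix (Fin N) (Fin N) ℂ) (specialUnitaryUnits (Fin N))) (fun x => (ops x).GD)
      (fun x => (ops x).G₁) (fun x => (ops x).H) (fun x => (ops x).H₁) (fun x => (ops x).HasRWExp) (fun x => (ops x).HasRWExpH)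
      (fun x => (ops x).PosDefK))
    (t313 : B9.Thm313Printed c35Y geo9Y (bg9Y (Matrix (Fin N) (Fin N) ℂ) (specialUnitaryUnits (Fin N))) (fun x => (ops x).GG)
      (fun x => (ops x).HasRWExp) (fun x => (ops x).PosDefK))
    (t314 : B9.Thm314Printed c35Y geo9Y (bg9Y (Matrix (Fin N) (Fin N) ℂ) (specialUnitaryUnits (Fin N))) (fun x => (ops x).Kdiff) dOmegaY)
    (t315 : B9.Thm315FullPrinted c35Y geo9Y (bg9Y (Matrix (Fin N) (Fin N) ℂ) (specialUnitaryUnits (Fin N))) (fun x => (ops x).Ck) inΛY unitDistY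
      (fun x => (ops x).GivenBy3185) (fun x => (ops x).HasRWExpC))
    (s349 : B9.Stmt349Printed (θ.d₆ + 1) c35Y geo9Y (bg9Y (Matrix (Fin N) (Fin N) ℂ) (specialUnitaryUnits (Fin N))) (fun x => (ops x).P349))
    (s3132 : B9.Stmt3132Printed (θ.d₆ + 1) c35Y geo9Y (bg9Y (Matrix (Fin N) (Fin N) ℂ) (specialUnitaryUnits (Fin N))) (fun x => (ops x).QGQinv)
      (fun x => (ops x).QG1Qinv))
    (t314loc : B9Thm314.Thm314LocalPrinted c35Y geo9Y (bg9Y (Matrix (Fin N) (Fin N) ℂ) (specialUnitaryUnits (Fin N))) (fun x => (ops x).Kdiff)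
      OmKY dOmegaY)
    (P : B12.RunParams) : Dag.B9_main (leavesP w P) :=
  b9_main_of_up_view₁₁B10YZW θ Mstar ops ζ lamW w hup
    (b9LeafX_Y9OfRecord_of_obligations θ.toStage3Params hθ.1.1.1.1.1 Mstar ops hGp_e hGp_h1 hC hGA_e hGA_h1 hGA_e4 hGA_h2 hGA_l2 hE4 hH2 hGp hGA hB
      hg t37 c38 t39 t310 hsum hksum t311 t312 t313 t314 t315 s349 s3132 t314loc) P

end Pointed

/-! ## §3 guards — why the ∀-form over ₁₁CB10YZW is not a discharge target, and what N06 costs in K1's ∃-currency -/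

section Guards

variable {F : T4Family}

/-- **A WORLD PRESENTED BY A GIVEN OPERATOR LAYER, at Stage 11**: every admissible Stage-11 parameter with its provisos and a positive window, EVERY floor, EVERY
operator layer `ops` (and any [B11] ∕ [IV] layers) present a ₁₁CB10YZW record `(datumOfRecord₁₁ θ h, w)` whose `b9` leaf IS `B9LeafX (Y9OfRecord N θ₃ M⋆ ops)` at every
run (g31's `exists_world_isRecordOfRecord₁₁CB10YZW`, rebuilt with the pin exposed). [cite: Balaban1985BackgroundPropagators, Thms 3.1–3.15 pp.397–432 (bookkeeping: the record's `b9` face)] -/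
theorem exists_record₁₁CB10YZW_leaf_iff (θ : Stage11Params F N) (h : θ.Provisos₁₁) (hθ : θ.Admissible) (hγ : 0 < θ.γ) (Mstar : ℕ)
    (ops : OpsY N θ.toStage3Params Mstar) (ζ : ResidZ F N) (lamW : ResidW F N) :
    ∃ w : WorldP, IsRecordOfRecord₁₁CB10YZW F N (datumOfRecord₁₁ F N θ h) w ∧
      (∀ P, w.up P = upOfRecord₅C F N (θ.view₁₁B10YZW F N Mstar ops ζ lamW) P) ∧
      ∀ P : B12.RunParams, ((leavesP w P).b9 ↔ B9LeafX (Y9OfRecord N θ.toStage3Params Mstar ops)) := by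
  obtain ⟨w₀, -, -⟩ := exists_world_isRecordOfRecord₁₁C F N θ h hθ ⟨hγ, le_rfl⟩
  refine ⟨{ w₀ with
      C := (datumOfRecord₁₁ F N θ h).C, γ := θ.γ, L := (θ.L : ℝ), one_lt_L := by exact_mod_cast θ.hL.2,
      up := fun P => upOfRecord₅C F N (θ.view₁₁B10YZW F N Mstar ops ζ lamW) P },
    ⟨θ, h, Mstar, ops, ζ, lamW, hθ, rfl, rfl, ⟨hγ, le_rfl⟩, rfl, fun _ => rfl⟩, fun _ => rfl, fun P => ?_⟩
  exact (upOfRecord₅C_view₁₁B10YZW_leaves F N θ Mstar ops ζ lamW P).2.1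

/-- **THE STAGE-11-PRESENTED DICTIONARIES, BY NAME**: `S_N06 (₁₁CB10YZW)` ⟺ «for every family, every admissible `θ : Stage11Params` satisfying its provisos with `0 < θ.γ`,
EVERY floor and EVERY operator layer: `B9LeafX (Y9OfRecord N θ.toStage3Params M⋆ ops)`» — the face that is NEW at ₁₁ (the ∀-form read through g31's pins; the [B11] ∕
[IV] layers drop out since the [B9] face does not read them; `nonempty_residZ ∕ nonempty_residW` supply them). [cite: Balaban1985BackgroundPropagators, Thms 3.1–3.15 pp.397–432 (bookkeeping)] -/
theorem s_N06_iff₁₁CB10YZW_bundles :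
    S_N06 (fun F D w => IsRecordOfRecord₁₁CB10YZW F N D w) ↔
      ∀ (F : T4Family) (θ : Stage11Params F N) (_ : θ.Provisos₁₁), θ.Admissible → 0 < θ.γ →
        ∀ (Mstar : ℕ) (ops : OpsY N θ.toStage3Params Mstar), B9LeafX (Y9OfRecord N θ.toStage3Params Mstar ops) := by
  refine ⟨fun hS F θ h hθ hγ Mstar ops => ?_, fun H F D w h P => ?_⟩
  · obtain ⟨ζ⟩ := nonempty_residZ F N
    obtain ⟨lamW⟩ := nonempty_residW F N
    obtain ⟨w, hw, -, hiff⟩ := exists_record₁₁CB10YZW_leaf_iff θ h hθ hγ Mstar ops ζ lamW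
    let P₀ : B12.RunParams := ⟨0, 0, 0⟩
    exact (hiff P₀).1 ((b9_main_iff_leaf_of_isRecordOfRecord₁₁CB10YZW hw P₀).1 (hS F _ w hw P₀))
  · obtain ⟨θ, hP, Mstar, ops, ζ, lamW, hθ, -, -, hγ, -, hup⟩ := h
    exact b9_main_of_up_view₁₁B10YZW θ Mstar ops ζ lamW w hup (H F θ hP hθ (hγ.1.trans_le hγ.2) Mstar ops) P

/-- **THE ∀-FORM FORCES THE LEAF AT EVERY OPERATOR LAYER** (one direction of `s_N06_iff₁₁CB10YZW_bundles`, pointed): `S_N06 (₁₁CB10YZW)` implies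
`B9LeafX (Y9OfRecord N θ₃ M⋆ ops)` for EVERY admissible Stage-11 parameter `θ` with provisos and `γ > 0`, EVERY floor, EVERY operator layer — in particular at layers
whose data violate print.  This is WHY the ∀-form over ₁₁CB10YZW is not an N06 target (plan rev-1: socket form). [cite: Balaban1985BackgroundPropagators, Thms 3.1–3.15 pp.397–432 (bookkeeping)] -/
theorem b9LeafX_of_s_N06_record₁₁CB10YZW (hS : S_N06 (fun F D w => IsRecordOfRecord₁₁CB10YZW F N D w))
    (θ : Stage11Params F N) (h : θ.Provisos₁₁) (hθ : θ.Admissible) (hγ : 0 < θ.γ) (Mstar : ℕ) (ops : OpsY N θ.toStage3Params Mstar) :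
    B9LeafX (Y9OfRecord N θ.toStage3Params Mstar ops) :=
  s_N06_iff₁₁CB10YZW_bundles.1 hS F θ h hθ hγ Mstar ops

/-- **ONE BAD OPERATOR LAYER REFUTES THE ∀-FORM**: an operator layer (over an admissible Stage-11 parameter with provisos and `γ > 0`) at whose bundle of record the
extended leaf FAILS makes `S_N06 (₁₁CB10YZW)` FALSE — the record predicate puts no law on `ops`. (Typed, not asserted: no bad layer is constructed here.)
[cite: Balaban1985BackgroundPropagators, Thms 3.1–3.15 pp.397–432 (bookkeeping)] -/
theorem not_s_N06_record₁₁CB10YZW_of_badOps (θ : Stage11Params F N) (h : θ.Provisos₁₁) (hθ : θ.Admissible) (hγ : 0 < θ.γ) (Mstar : ℕ)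
    (ops : OpsY N θ.toStage3Params Mstar) (hbad : ¬ B9LeafX (Y9OfRecord N θ.toStage3Params Mstar ops)) :
    ¬ S_N06 (fun F D w => IsRecordOfRecord₁₁CB10YZW F N D w) :=
  fun hS => hbad (b9LeafX_of_s_N06_record₁₁CB10YZW hS θ h hθ hγ Mstar ops)

/-- **N06 HOLDS AT THE JUNK-PRESENTED STAGE-11 RECORDS — INHABITED, NON-VACUOUS, CONTENT-FREE**: every admissible Stage-11 parameter with its provisos and `γ > 0`, every
floor, is presented (with def-Y's ZERO operator layer `exists_junkOps_b9LeafX_Y9OfRecord`, `Gp.e ≡ 0`, and any [B11] ∕ [IV] layers) by a ₁₁CB10YZW record at which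
`Dag.B9_main` holds at EVERY run.  So a sentence «N06 holds at some ∕ these ₁₁CB10YZW records» certifies nothing about Bałaban's propagators (A6 located), and the
∀-form fails for bad layers (`not_s_N06_record₁₁CB10YZW_of_badOps`): either way NOT-A-DISCHARGE; the operator layer (XL) is the next pin.
[cite: Balaban1985BackgroundPropagators, Thms 3.1–3.15 pp.397–432 (bookkeeping: junk satisfiability of the typed leaf)] -/
theorem exists_record₁₁CB10YZW_b9_main_junk (θ : Stage11Params F N) (h : θ.Provisos₁₁) (hθ : θ.Admissible) (hγ : 0 < θ.γ) (Mstar : ℕ)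
    (ζ : ResidZ F N) (lamW : ResidW F N) :
    ∃ (ops : OpsY N θ.toStage3Params Mstar) (w : WorldP),
      (∀ (x : MemberY θ.d₆ θ.ℓ₆ θ.hd' θ.hL' θ.b₀ θ.b₁ Mstar) (n : Fin 4) (U : (bg9Y (Matrix (Fin N) (Fin N) ℂ) (specialUnitaryUnits (Fin N)) x).Cfg)
          (lam : (geo9Y x).Loc) (y : (geo9Y x).Site), (ops x).Gp.e n U lam y = 0) ∧
      IsRecordOfRecord₁₁CB10YZW F N (datumOfRecord₁₁ F N θ h) w ∧ ∀ P : B12.RunParams, Dag.B9_main (leavesP w P) := by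
  obtain ⟨ops, hzero, hleaf⟩ := exists_junkOps_b9LeafX_Y9OfRecord (N := N) θ.toStage3Params hθ.1.1.1.1.1 Mstar
  obtain ⟨w, hw, hup, -⟩ := exists_record₁₁CB10YZW_leaf_iff θ h hθ hγ Mstar ops ζ lamW
  exact ⟨ops, w, hzero, hw, b9_main_of_up_view₁₁B10YZW θ Mstar ops ζ lamW w hup hleaf⟩

variable (F) in
/-- **INHABITED-AT-₁₁CB10YZW ⟺ INHABITED-AT-₁₁C, family by family** (the four carrier pins add no proviso and no admissibility clause): refinement
`Node00.isRecordOfRecord₁₁C_of_isRecordOfRecord₁₁CB10YZW` one way; the other way a ₁₁C record RE-BINDS to a ₁₁CB10YZW record with the SAME datum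
(`Node00.isRecordOfRecord₁₁CB10YZW_rebind_of_isRecordOfRecord₁₁C`) for ANY floor (here `0`), def-Y's junk operator layer and any residual [B11] ∕ [IV] layers
(`nonempty_residZ`, `nonempty_residW`).  At `N = 2` the right-hand side is K0 `Record11Inhabited`'s body on the family — neither proved nor assumed in this file.
[cite: Balaban1989LargeFieldII, Thm 1 + (0.1) pp.355–356 (objects of record; bookkeeping)] -/
theorem inhabited₁₁CB10YZW_iff_inhabited₁₁C :
    (∃ (D : Datum F N) (w : WorldP), IsRecordOfRecord₁₁CB10YZW F N D w) ↔
      ∃ (D : Datum F N) (w : WorldP), IsRecordOfRecord₁₁C F N D w := by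
  refine ⟨fun ⟨D, w, h⟩ => ⟨D, w, isRecordOfRecord₁₁C_of_isRecordOfRecord₁₁CB10YZW h⟩, fun ⟨D, w, h⟩ => ?_⟩
  obtain ⟨θ, _, hθ, -, h11⟩ := isRecordOfRecord₁₁CB10YZW_rebind_of_isRecordOfRecord₁₁C h
  obtain ⟨ops, -, -⟩ := exists_junkOps_b9LeafX_Y9OfRecord (N := N) θ.toStage3Params hθ.1.1.1.1.1 0
  obtain ⟨ζ⟩ := nonempty_residZ F N
  obtain ⟨lamW⟩ := nonempty_residW F N
  exact ⟨D, _, h11 0 ops ζ lamW⟩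

/-- **WHAT N06 COSTS IN K1's ∃-CURRENCY TODAY — NOTHING (LOCATED)**: every Stage-11 record `(D, w)` of `IsRecordOfRecord₁₁C` is RE-PRESENTED — SAME datum `D`, same
construction, window and block size — by a ₁₁CB10YZW world `w′` (the four-pin view over the record's own parameters with def-Y's ZERO operator layer) at which
`Dag.B9_main (leavesP w′ P)` holds at EVERY run.  So in the V1 ∃-form of K1 `StabilityBAtRecordR11e` (the prover chooses the record) the N06 conjunct of
`DagBinding.Nodes` is closable content-free; it constrains the construction only once the operator layer `ops` is an OBJECT OF RECORD meeting the obligations of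
`b9_main_of_up_view₁₁B10YZW_of_obligations` for Bałaban's `G′(U), G(U), …` (FAN-OUT §N06 row s1 (β); ref-A's clause of record, INBOX l.11134 (K2)).  NOT-A-DISCHARGE.
[cite: Balaban1985BackgroundPropagators, Thms 3.1–3.15 pp.397–432 (bookkeeping: junk satisfiability at the Stage-11 record)] -/
theorem exists_rebind₁₁CB10YZW_b9_main_of_isRecordOfRecord₁₁C {D : FiniteEpsData F (Node00.SU N)} {w : WorldP} (h : IsRecordOfRecord₁₁C F N D w) :
    ∃ w' : WorldP, IsRecordOfRecord₁₁CB10YZW F N D w' ∧ w'.C = w.C ∧ w'.γ = w.γ ∧ w'.L = w.L ∧ ∀ P : B12.RunParams, Dag.B9_main (leavesP w' P) := by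
  obtain ⟨θ, _, hθ, -, h11⟩ := isRecordOfRecord₁₁CB10YZW_rebind_of_isRecordOfRecord₁₁C h
  obtain ⟨ops, -, hleaf⟩ := exists_junkOps_b9LeafX_Y9OfRecord (N := N) θ.toStage3Params hθ.1.1.1.1.1 0
  obtain ⟨ζ⟩ := nonempty_residZ F N
  obtain ⟨lamW⟩ := nonempty_residW F N
  exact ⟨_, h11 0 ops ζ lamW, rfl, rfl, rfl, b9_main_of_up_view₁₁B10YZW θ 0 ops ζ lamW _ (fun _ => rfl) hleaf⟩

end Guards

end Summit.QuantumFields.YangMills.BalabanUVNodes.N06AtRecord11CB10YZW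

end
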